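import Literature.MathematicalPhysics.QuantumFieldTheory.Balaban1983to89.B4Thm110BoxDerivUniform
import Literature.MathematicalPhysics.QuantumFieldTheory.Balaban1983to89.B4Lemma22BoxNoCollar

/-!
# `Balaban1983to89.B4Thm110BoxNoCollar` — [Balaban1983RegularityDecay] THEOREM p. 573, (1.10) value AND derivative
# members, ON A BOX, FOR EVERY (1.7)-REGULAR FIELD — **NO COLLAR HYPOTHESIS** («for rectangular parallelepipeds, the
# inequalities hold without any restrictions», p. 573; «we can apply Lemma 2.2 to all operators in it», p. 579)

statement-level skeleton of published theorems with citation tags; proofs where landed; nothing here is a claim about the Yang–Mills mass gap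

CITATION HEADER.  T. Bałaban, *Regularity and decay of lattice Green's functions*, Commun. Math. Phys. **89** (1983)
571–597, doi:10.1007/bf01214744 [Balaban1983RegularityDecay] (cell paper B4; held text
`paper:balaban1983-cmp89-regularity-decay`, journal page = PDF page + 570; pp. 573, 575–579, 581).  Unit
`lit-balaban-r04` gen 15 (B4 second reader; HOME `run/shared/lean/pub/lit-balaban/`), SKELETON row **B4.Thm@573**
(Theorem p. 573, (1.10) value member, rectangular `Ω`); HOME/GAPS.md **G-B4-p17-02** — step (4) of the collar-drop
programme (r01 ruling 2026-08-22T10:13Z; p17 interface 2026-08-22T10:10Z).  Imports p17 g5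
`B4Thm110BoxDerivUniform` (→ `B4Thm110BoxUniform`, `B4Thm110BoxCut.thm110_value_boxCut` and
`B4Thm110BoxDerivCut.thm110_deriv_boxCut`, the walk route with the print's cut cubes; `regular_shift`; the label
bookkeeping `labelsK`, `jloc`, `cubeMs_eq/le`, `one_le_cubeMs`, `dvd_cubeMs`) and r04 g15 `B4Lemma22BoxNoCollar`
(`lemma22_sup_noCollar`, `eq220_noCollar`: Lemma 2.2 (2.17) sup members and (2.20) for `G_k(□, A)` at a
(1.7)-regular `A` with no collar).

WHAT IS PRINTED.  p. 573: «Theorem. … there exist positive constants δ₀, c₀, R₀ independent of A, k, Ω and depending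
on d, M only … such that for e sufficiently small … |(G_k(Ω, A)f)(x)| ≤ c₀ exp(−δ₀ dist(x, supp f)) ‖f‖_∞ (1.10) …
For some simple sets Ω, e.g. for rectangular parallelepipeds, the inequalities hold without any restrictions on the
points x, x′»; p. 575 «□_j = Ω ∩ {…}» and, at the cubes meeting `∂Ω`, the choice «Ã_j = A»; p. 579 «if Ω is a
rectangular parallelepiped, then all □_j in the representation (2.13) are cubes and we can apply Lemma 2.2 to all
operators in it».

WHY THIS FILE (versus p17 g5's `B4Thm110BoxUniform.thm110_value_box_uniform`).  p17's hypothesis-free box theorem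
carries «`A = A(0)` on the collar of width `K` at `∂Ω`» (HOME/GAPS.md G-B4-p17-02: the lineage's Lemma 2.2 needs `Ã_j`
constant near `∂□_j`, and at a boundary cube `□_j` of a parallelepiped `Ã_j` must agree with `A` up to `∂Ω`).  With
`B4Lemma22BoxNoCollar` the per-cube inputs of `thm110_value_boxCut` hold for `Ã_j := A` on EVERY cut cube (plateau
agreement trivial), so the collar clause DROPS: this file is (1.10), value member, on a box for every (1.7)-regular
`A`, «e sufficiently small» depending on `(c, β)` and the fixed data only — the print's parallelepiped sentence.

WHAT THIS MODULE PROVES (in full).  **`thm110_value_box_noCollar`** — `∃ K` (`8 ≤ K`, `4 ∣ K`), `∃ c₀ > 0`,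
`∀ (c, β)` `∃ e₁ > 0` — BEFORE the box — such that for every `k ≥ 1`, `(a, m²)` in the window, EVERY box
`Ω = Π[0, nMb_μ)` with `K ∣ Mb_μ`, `1 ≤ Mb_μ` (no size bound), every component field `A` with
`|A_ν(x + e_μ) − A_ν(x)| ≤ ce^{β−1}/n` for `x ∈ Ω` ((1.7); NOTHING at `∂Ω`) and `0 < e ≤ e₁`, every fine site `x`,
every `f` supported at sup-distance `≥ D` (unit lattice) from `x`: `|(G_k(Ω,A)f)(x)_i| ≤ c₀·e^{−D/K}·‖f‖_∞`;
**`thm110_deriv_box_noCollar`** — the same for the covariant derivative `|(D^η_{A,μ}G_k(Ω,A)f)(x)_i|` at every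
`μ`-bond `(x, x+e_μ)` of `Ω` (constant `c₁`).
HONEST SCOPE.  (i) Value and derivative members of (1.10) only (Hölder (1.9)/(2.16) and `δG` (1.11)–(1.12) members:
the same substitution in `B4Thm19BoxHolderCut` / `B4Thm112Box*` needs the Hölder member of Lemma 2.2 without collar —
sequel); (ii) `d ≥ 1`; (iii) the lineage's (1.6) (abelian one-parameter orthogonal flow, component field, corner embedding
and staircase contours, running coefficient `a_kη^{d+1}`, charge `eη`); (iv) `δ₀ = 1/K` per unit length; `c₀`, `K`
depend on `(d, N, ℓ₁, L, a₋, a₊, m²₊)`, `e₁` on these and `(c, β)` ONLY; (v) the gauge `λ` behind the per-cube inputs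
is ours (`B4BoxNeumannGauge`).  Theorems only; no `def`, no `Prop` fact, no `sorry`; axioms standard.
-/

namespace Literature.MathematicalPhysics.QuantumFieldTheory.Balaban1983to89.B4Thm110BoxNoCollar

open Literature.MathematicalPhysics.QuantumFieldTheory.Balaban1983to89.B4Reflection242 (boxDom mem_boxDom nbrs mem_nbrs)
open Literature.MathematicalPhysics.QuantumFieldTheory.Balaban1983to89.B4GaugeCovariance
open Literature.MathematicalPhysics.QuantumFieldTheory.Balaban1983to89.B4Commutators25to211 (mulH)
open Literature.MathematicalPhysics.QuantumFieldTheory.Balaban1983to89.B4Lower18Regular (e1 baseEmb stairContour)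
open Literature.MathematicalPhysics.QuantumFieldTheory.Balaban1983to89.B4Lower18RegularRegion (compField)
open Literature.MathematicalPhysics.QuantumFieldTheory.Balaban1983to89.B4Lemma22ReduceZero (Box opA greenA)
open Literature.MathematicalPhysics.QuantumFieldTheory.Balaban1983to89.B4Lemma22Reduce231 (supN supN_nonneg)
open Literature.MathematicalPhysics.QuantumFieldTheory.Balaban1983to89.B4Eq220PartitionSizes (hBox)
open Literature.MathematicalPhysics.QuantumFieldTheory.Balaban1983to89.B4Eq220CommutatorField (kOp)
open Literature.MathematicalPhysics.QuantumFieldTheory.Balaban1983to89.B4SubBoxCarrier (subEmb)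
open Literature.MathematicalPhysics.QuantumFieldTheory.Balaban1983to89.B4CubeGreenBox (subField)
open Literature.MathematicalPhysics.QuantumFieldTheory.Balaban1983to89.B4BoxCubeGeometry (posR cubeLo cubeMs cube_ho)
open Literature.MathematicalPhysics.QuantumFieldTheory.Balaban1983to89.B4Thm110BoxCut
open Literature.MathematicalPhysics.QuantumFieldTheory.Balaban1983to89.B4Thm110BoxUniform (regular_shift)
open Literature.MathematicalPhysics.QuantumFieldTheory.Balaban1983to89.B4Thm110BoxDerivCut (thm110_deriv_boxCut)
open Literature.MathematicalPhysics.QuantumFieldTheory.Balaban1983to89.B4PartitionUnity22 (hprof D1 D2 D1_nonneg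
  D2_nonneg contDiff_hprof hasCompactSupport_hprof)
open Literature.MathematicalPhysics.QuantumFieldTheory.Balaban1983to89.B4Lemma22ReduceZero (derivA)
open Literature.MathematicalPhysics.QuantumFieldTheory.Balaban1983to89.B4Lemma22BoxNoCollar (lemma22_sup_noCollar
  eq220_noCollar)
open scoped Matrix

noncomputable section

variable {d : ℕ}

section Main

variable {ι : Type} [Fintype ι] [DecidableEq ι]

/-- **`Ã_j = A` ON THE SUB-BOX IS THE TRANSLATED COMPONENT FIELD**: the restriction of the component bond function
along `□_j` is the component bond function of `A^{(j)}_ν(y) = A_ν(y + n·cubeLo j)`.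
[cite: Balaban1983RegularityDecay, §2 p.575 «Ã_j = A», dictionary] -/
theorem subField_compField {ℓ k : ℕ} {Mb : Fin (d + 1) → ℕ} {K : ℕ} (j : Fin (d + 1) → ℤ)
    (Ac : (Fin (d + 1) → ℤ) → Fin (d + 1) → ℝ) :
    subField ℓ k Mb (cubeMs Mb K j) (cubeLo Mb K j) (cube_ho Mb K j)
        (fun u v : ↥(Box d ℓ k Mb) => compField Ac u.1 v.1)
      = fun u v : ↥(Box d ℓ k (cubeMs Mb K j)) =>
          compField (fun y => Ac (y + fun i => (((ℓ + 1) ^ k : ℕ) : ℤ) * (cubeLo Mb K j i : ℤ))) u.1 v.1 := by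
  funext a b
  set e := subEmb ℓ k Mb (cubeMs Mb K j) (cubeLo Mb K j) (cube_ho Mb K j) with he
  have hea : ∀ c : ↥(Box d ℓ k (cubeMs Mb K j)),
      (e c).1 = c.1 + fun i => (((ℓ + 1) ^ k : ℕ) : ℤ) * (cubeLo Mb K j i : ℤ) := fun c => rfl
  show compField Ac (e a).1 (e b).1 = _
  rw [hea a, hea b]
  exact B4RegionCubeCarrier.compField_add Ac a.1 b.1 _

/-- **THEOREM (1.10) OF [B4] ON A BOX, VALUE MEMBER — FOR EVERY (1.7)-REGULAR FIELD, NO COLLAR, WITH «e SUFFICIENTLY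
SMALL» UNIFORM IN `Ω`** (pp. 573–579; the print's cut cubes with «Ã_j = A» on every cube): there are `K` (`8 ≤ K`,
`4 ∣ K`) and `c₀ > 0` (depending on the structure group data, `d`, `L`, the window) such that for all `c ≥ 0`, `β > 0`
there is `e₁ > 0` with — for every `k ≥ 1`, `(a,m²) ∈ [a₋,a₊]×[0,m²₊]`, EVERY box `Ω = Π[0, nMb_μ)` with `K ∣ Mb_μ`,
`1 ≤ Mb_μ` (no size bound), EVERY component field `A` with `|A_ν(x+e_μ) − A_ν(x)| ≤ c·e^{β−1}η` on `Ω` ((1.7), no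
condition at `∂Ω`), `0 < e ≤ e₁`, every fine site `x`, every set `P` with `|x/n − x′/n|_∞ ≥ D` on `P`, every source `f`
supported in `P` with `|f| ≤ φ` — `|(G_k(Ω,A)f)(x)_i| ≤ c₀·e^{−D/K}·φ` (`δ₀ = 1/K` per unit length; constants
«independent of A, k, Ω»; «for rectangular parallelepipeds, the inequalities hold without any restrictions»).
[cite: Balaban1983RegularityDecay, Theorem (1.10) p.573; pp.575–579] -/
theorem thm110_value_box_noCollar (F : OrthFlow ι) {ℓ₁ : ℝ} (hℓ₁ : 0 ≤ ℓ₁)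
    (hLip : ∀ t (v : ι → ℝ), ((F.U t - 1) *ᵥ v) ⬝ᵥ ((F.U t - 1) *ᵥ v) ≤ (ℓ₁ * t) ^ 2 * (v ⬝ᵥ v))
    (d ℓ : ℕ) (hd : 1 ≤ d) (hℓ : 1 ≤ ℓ) (amin aplus m2plus : ℝ) (ha : 0 < amin) :
    ∃ K : ℕ, 8 ≤ K ∧ 4 ∣ K ∧ ∃ c₀ : ℝ, 0 < c₀ ∧ ∀ (creg β : ℝ), 0 ≤ creg → 0 < β →
      ∃ e₁ : ℝ, 0 < e₁ ∧ ∀ (k : ℕ), 1 ≤ k → ∀ (hn : 1 ≤ (ℓ + 1) ^ k) (a m2 : ℝ),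
      amin ≤ a → a ≤ aplus → 0 ≤ m2 → m2 ≤ m2plus →
      ∀ (Mb : Fin (d + 1) → ℕ), (∀ i, 1 ≤ Mb i) → (∀ μ, K ∣ Mb μ) →
      ∀ (Ac : (Fin (d + 1) → ℤ) → Fin (d + 1) → ℝ) (e : ℝ), 0 < e → e ≤ e₁ →
        (∀ x ∈ Box d ℓ k Mb, ∀ μ ν : Fin (d + 1),
          |Ac (x + e1 μ) ν - Ac x ν| ≤ creg * e ^ (β - 1) / ((ℓ + 1) ^ k : ℕ)) →
      ∀ (x : ↥(Box d ℓ k Mb)) (P : ↥(Box d ℓ k Mb) → Prop) [DecidablePred P] (D : ℝ),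
        (∀ x', P x' → ∃ μ, D ≤ |posR ℓ k Mb x μ - posR ℓ k Mb x' μ|) →
      ∀ (f : ↥(Box d ℓ k Mb) × ι → ℝ), (∀ p, ¬ P p.1 → f p = 0) → ∀ (φ : ℝ), 0 ≤ φ → (∀ p, |f p| ≤ φ) →
      ∀ i : ι,
        |(greenA d F (e / ((ℓ + 1) ^ k : ℕ)) ℓ k a m2 Mb (baseEmb hn Mb) (stairContour hn Mb)
            (fun u v : ↥(Box d ℓ k Mb) => compField Ac u.1 v.1) *ᵥ f) (x, i)|
          ≤ c₀ * Real.exp (-(D / K)) * φ := by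
  obtain ⟨C₁, hC₁, h₁⟩ := lemma22_sup_noCollar F hℓ₁ hLip d ℓ hℓ amin aplus m2plus ha
  obtain ⟨C₂, hC₂, h₂⟩ := eq220_noCollar F hℓ₁ hLip d ℓ hℓ amin aplus m2plus ha
  set X : ℝ := (3 : ℝ) ^ (d + 1) * Real.sqrt (Fintype.card ι) * C₂ * Real.exp 1 with hX
  have hX0 : 0 ≤ X := by positivity
  set K : ℕ := 8 * (⌈X⌉₊ + 1) with hK
  have hK8 : 8 ≤ K := by omega
  have h4 : 4 ∣ K := ⟨2 * (⌈X⌉₊ + 1), by omega⟩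
  have hK1 : 1 ≤ K := by omega
  have hKr : (0 : ℝ) < K := by exact_mod_cast hK1
  have hKX : X ≤ K := by
    refine (Nat.le_ceil X).trans ?_
    rw [hK]
    push_cast
    linarith [(Nat.cast_nonneg ⌈X⌉₊ : (0 : ℝ) ≤ ⌈X⌉₊)]
  set cK : ℝ := C₂ / K with hcK_def
  have hcK : 0 ≤ cK := div_nonneg hC₂.le hKr.le
  have h3 : (3 : ℝ) ^ (d + 1) * (Real.sqrt (Fintype.card ι) * cK) ≤ Real.exp (-1) := by
    have hexp : Real.exp 1 * Real.exp (-1) = 1 := by rw [← Real.exp_add]; norm_num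
    have e : (3 : ℝ) ^ (d + 1) * (Real.sqrt (Fintype.card ι) * cK) = X / K * Real.exp (-1) := by
      rw [hcK_def, hX]
      calc (3 : ℝ) ^ (d + 1) * (Real.sqrt (Fintype.card ι) * (C₂ / K))
          = (3 : ℝ) ^ (d + 1) * Real.sqrt (Fintype.card ι) * C₂ / K * (Real.exp 1 * Real.exp (-1)) := by
            rw [hexp]; ring
        _ = (3 : ℝ) ^ (d + 1) * Real.sqrt (Fintype.card ι) * C₂ * Real.exp 1 / K * Real.exp (-1) := by ring
    rw [e]
    have : X / K ≤ 1 := div_le_one_of_le₀ hKX (Nat.cast_nonneg K)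
    calc X / K * Real.exp (-1) ≤ 1 * Real.exp (-1) := mul_le_mul_of_nonneg_right this (Real.exp_pos _).le
      _ = Real.exp (-1) := one_mul _
  set c₀ : ℝ := 2 ^ (d + 2) * Real.exp (9 / 4) * max (Real.sqrt (Fintype.card ι) * C₁) 2 + 1 with hc₀
  refine ⟨K, hK8, h4, c₀, by positivity, fun creg β hcreg hβ => ?_⟩
  -- the thresholds at the side bound `2K` of the CUT cubes — uniform in `Ω`
  obtain ⟨e₁, he₁, h₁'⟩ := h₁ creg β hcreg hβ (2 * K)
  obtain ⟨e₂, he₂, h₂'⟩ := h₂ creg β hcreg hβ (2 * K) K hK1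
  refine ⟨min e₁ e₂, lt_min he₁ he₂, ?_⟩
  intro k hk hn a m2 ea1 ea2 em1 em2 Mb hM hKM Ac e he hle h17 x P _ D hD f hfP φ hφ hf i
  have hn2 : 2 ≤ (ℓ + 1) ^ k := by
    calc 2 ≤ ℓ + 1 := by omega
      _ = (ℓ + 1) ^ 1 := (pow_one _).symm
      _ ≤ (ℓ + 1) ^ k := Nat.pow_le_pow_right (Nat.succ_pos ℓ) hk
  have hnK : 16 ≤ (ℓ + 1) ^ k * K := by nlinarith
  have hnK3 : 3 ≤ (ℓ + 1) ^ k * K := le_trans (by norm_num) hnK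
  have ha' : 0 < a := lt_of_lt_of_le ha ea1
  -- the translated field of the cube `j`, (1.7)-regular on the sub-box with the same bound
  set AcS : (Fin (d + 1) → ℤ) → (Fin (d + 1) → ℤ) → Fin (d + 1) → ℝ :=
    fun j y => Ac (y + fun i => (((ℓ + 1) ^ k : ℕ) : ℤ) * (cubeLo Mb K j i : ℤ)) with hAcS
  have hregS : ∀ j, ∀ y ∈ Box d ℓ k (cubeMs Mb K j), ∀ μ ν : Fin (d + 1),
      |AcS j (y + e1 μ) ν - AcS j y ν| ≤ creg * e ^ (β - 1) / ((ℓ + 1) ^ k : ℕ) :=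
    fun j => regular_shift (Mb := Mb) (K := K) j h17
  -- the sub-box data at every label
  have hMs1 : ∀ j ∈ labelsK Mb K, ∀ μ, 1 ≤ cubeMs Mb K j μ := fun j hj μ => one_le_cubeMs hK1 hKM hM hj μ
  have hMsS : ∀ j ∈ labelsK Mb K, ∀ μ, cubeMs Mb K j μ ≤ 2 * K := fun j hj μ => cubeMs_le hK1 hKM hM hj μ
  have hMsK : ∀ j ∈ labelsK Mb K, ∀ μ, K ∣ cubeMs Mb K j μ := fun j hj μ => dvd_cubeMs hK1 hKM hM hj μ
  have hMs3 : ∀ j ∈ labelsK Mb K, ∀ μ, 3 ≤ (ℓ + 1) ^ k * cubeMs Mb K j μ := fun j hj μ =>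
    hnK3.trans (Nat.mul_le_mul_left _ (Nat.le_of_dvd (hMs1 j hj μ) (hMsK j hj μ)))
  have hsub : ∀ j, subField ℓ k Mb (cubeMs Mb K j) (cubeLo Mb K j) (cube_ho Mb K j)
      (fun u v : ↥(Box d ℓ k Mb) => compField Ac u.1 v.1)
      = fun u v : ↥(Box d ℓ k (cubeMs Mb K j)) => compField (AcS j) u.1 v.1 :=
    fun j => subField_compField j Ac
  -- the per-cube inputs, on EVERY cut cube, at `Ã_j = A`
  have hG : ∀ j ∈ labelsK Mb K, ∀ Φ : ↥(Box d ℓ k (cubeMs Mb K j)) × ι → ℝ,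
      supN (greenA d F (e / ((ℓ + 1) ^ k : ℕ)) ℓ k a m2 (cubeMs Mb K j) (baseEmb hn _) (stairContour hn _)
          (subField ℓ k Mb (cubeMs Mb K j) (cubeLo Mb K j) (cube_ho Mb K j)
            (fun u v : ↥(Box d ℓ k Mb) => compField Ac u.1 v.1)) *ᵥ Φ) ≤ C₁ * supN Φ := by
    intro j hj Φ
    rw [hsub j]
    exact (h₁' k hk hn a m2 ea1 ea2 em1 em2 (cubeMs Mb K j) (hMs1 j hj) (hMsS j hj) (hMs3 j hj) (AcS j) e he
      (hle.trans (min_le_left _ _)) (hregS j) Φ).1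
  have hKG : ∀ j ∈ labelsK Mb K, ∀ Φ : ↥(Box d ℓ k (cubeMs Mb K j)) × ι → ℝ,
      supN (kOp F (e / ((ℓ + 1) ^ k : ℕ)) ((ℓ + 1) ^ k) (B1.aSeq a ((ℓ : ℝ) + 1) k) m2 (cubeMs Mb K j)
            (baseEmb hn _) (stairContour hn _)
            (subField ℓ k Mb (cubeMs Mb K j) (cubeLo Mb K j) (cube_ho Mb K j)
              (fun u v : ↥(Box d ℓ k Mb) => compField Ac u.1 v.1))
            (hBox ((ℓ + 1) ^ k) K (cubeMs Mb K j) (jloc j))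
          *ᵥ (greenA d F (e / ((ℓ + 1) ^ k : ℕ)) ℓ k a m2 (cubeMs Mb K j) (baseEmb hn _) (stairContour hn _)
              (subField ℓ k Mb (cubeMs Mb K j) (cubeLo Mb K j) (cube_ho Mb K j)
                (fun u v : ↥(Box d ℓ k Mb) => compField Ac u.1 v.1))
            *ᵥ (mulH (ι := ι) (hBox ((ℓ + 1) ^ k) K (cubeMs Mb K j) (jloc j)) *ᵥ Φ))) ≤ cK * supN Φ := by
    intro j hj Φ
    rw [hsub j]
    exact h₂' k hk hn hnK3 a m2 ea1 ea2 em1 em2 (cubeMs Mb K j) (hMs1 j hj) (hMsS j hj) (hMsK j hj) (jloc j)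
      (AcS j) e he (hle.trans (min_le_right _ _)) (hregS j) Φ
  have main := thm110_value_boxCut F (e / ((ℓ + 1) ^ k : ℕ)) hℓ hk hn hd Mb hM hK8 h4 hKM ha' em1
    (fun u v : ↥(Box d ℓ k Mb) => compField Ac u.1 v.1) (fun _ u v => compField Ac u.1 v.1)
    (fun _ _ _ _ _ => rfl) hC₁.le hcK hG hKG h3 x P hD f hfP hφ hf i
  refine main.trans (mul_le_mul_of_nonneg_right (mul_le_mul_of_nonneg_right ?_ (Real.exp_pos _).le) hφ)
  rw [hc₀]
  linarith

/-- **THEOREM (1.10) OF [B4] ON A BOX, DERIVATIVE MEMBER — FOR EVERY (1.7)-REGULAR FIELD, NO COLLAR, WITH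
«e SUFFICIENTLY SMALL» UNIFORM IN `Ω`**: there are `K` (`8 ≤ K`, `4 ∣ K`) and `c₁ > 0` such that for all `c ≥ 0`,
`β > 0` there is `e₁ > 0` with — for every `k ≥ 1`, `(a,m²)` in the window, EVERY box `Ω = Π[0, nMb_μ)` with
`K ∣ Mb_μ`, `1 ≤ Mb_μ`, EVERY component field `A` (1.7)-regular on `Ω` (no condition at `∂Ω`), `0 < e ≤ e₁`, every
`μ`-bond `(x, x + e_μ)` of `Ω`, every `f` supported at sup-distance `≥ D` from `x` with `|f| ≤ φ` —
`|(D^η_{A,μ}G_k(Ω,A)f)(x)_i| ≤ c₁·e^{−D/K}·φ`.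
[cite: Balaban1983RegularityDecay, Theorem (1.10) p.573 (derivative member); pp.575–579] -/
theorem thm110_deriv_box_noCollar (F : OrthFlow ι) {ℓ₁ : ℝ} (hℓ₁ : 0 ≤ ℓ₁)
    (hLip : ∀ t (v : ι → ℝ), ((F.U t - 1) *ᵥ v) ⬝ᵥ ((F.U t - 1) *ᵥ v) ≤ (ℓ₁ * t) ^ 2 * (v ⬝ᵥ v))
    (d ℓ : ℕ) (hd : 1 ≤ d) (hℓ : 1 ≤ ℓ) (amin aplus m2plus : ℝ) (ha : 0 < amin) :
    ∃ K : ℕ, 8 ≤ K ∧ 4 ∣ K ∧ ∃ c₁ : ℝ, 0 < c₁ ∧ ∀ (creg β : ℝ), 0 ≤ creg → 0 < β →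
      ∃ e₁ : ℝ, 0 < e₁ ∧ ∀ (k : ℕ), 1 ≤ k → ∀ (hn : 1 ≤ (ℓ + 1) ^ k) (a m2 : ℝ),
      amin ≤ a → a ≤ aplus → 0 ≤ m2 → m2 ≤ m2plus →
      ∀ (Mb : Fin (d + 1) → ℕ), (∀ i, 1 ≤ Mb i) → (∀ μ, K ∣ Mb μ) →
      ∀ (Ac : (Fin (d + 1) → ℤ) → Fin (d + 1) → ℝ) (e : ℝ), 0 < e → e ≤ e₁ →
        (∀ x ∈ Box d ℓ k Mb, ∀ μ ν : Fin (d + 1),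
          |Ac (x + e1 μ) ν - Ac x ν| ≤ creg * e ^ (β - 1) / ((ℓ + 1) ^ k : ℕ)) →
      ∀ (μ : Fin (d + 1)) (x : ↥(Box d ℓ k Mb)), x.1 + e1 μ ∈ Box d ℓ k Mb →
      ∀ (P : ↥(Box d ℓ k Mb) → Prop) [DecidablePred P] (D : ℝ),
        (∀ x', P x' → ∃ ν, D ≤ |posR ℓ k Mb x ν - posR ℓ k Mb x' ν|) →
      ∀ (f : ↥(Box d ℓ k Mb) × ι → ℝ), (∀ p, ¬ P p.1 → f p = 0) → ∀ (φ : ℝ), 0 ≤ φ → (∀ p, |f p| ≤ φ) →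
      ∀ i : ι,
        |(derivA d F (e / ((ℓ + 1) ^ k : ℕ)) ℓ k Mb (fun u v : ↥(Box d ℓ k Mb) => compField Ac u.1 v.1) μ
            *ᵥ (greenA d F (e / ((ℓ + 1) ^ k : ℕ)) ℓ k a m2 Mb (baseEmb hn Mb) (stairContour hn Mb)
                (fun u v : ↥(Box d ℓ k Mb) => compField Ac u.1 v.1) *ᵥ f)) (x, i)|
          ≤ c₁ * Real.exp (-(D / K)) * φ := by
  obtain ⟨C₁, hC₁, h₁⟩ := lemma22_sup_noCollar F hℓ₁ hLip d ℓ hℓ amin aplus m2plus ha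
  obtain ⟨C₂, hC₂, h₂⟩ := eq220_noCollar F hℓ₁ hLip d ℓ hℓ amin aplus m2plus ha
  set X : ℝ := (3 : ℝ) ^ (d + 1) * Real.sqrt (Fintype.card ι) * C₂ * Real.exp 1 with hX
  have hX0 : 0 ≤ X := by positivity
  set K : ℕ := 8 * (⌈X⌉₊ + 1) with hK
  have hK8 : 8 ≤ K := by omega
  have h4 : 4 ∣ K := ⟨2 * (⌈X⌉₊ + 1), by omega⟩
  have hK1 : 1 ≤ K := by omega
  have hKr : (0 : ℝ) < K := by exact_mod_cast hK1
  have hKX : X ≤ K := by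
    refine (Nat.le_ceil X).trans ?_
    rw [hK]
    push_cast
    linarith [(Nat.cast_nonneg ⌈X⌉₊ : (0 : ℝ) ≤ ⌈X⌉₊)]
  set cK : ℝ := C₂ / K with hcK_def
  have hcK : 0 ≤ cK := div_nonneg hC₂.le hKr.le
  have hs0 : 0 ≤ ((d : ℝ) + 1) * (D1 hprof + D2 hprof) := by
    have := D1_nonneg contDiff_hprof hasCompactSupport_hprof
    have := D2_nonneg contDiff_hprof hasCompactSupport_hprof
    positivity
  have h3 : (3 : ℝ) ^ (d + 1) * (Real.sqrt (Fintype.card ι) * cK) ≤ Real.exp (-1) := by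
    have hexp : Real.exp 1 * Real.exp (-1) = 1 := by rw [← Real.exp_add]; norm_num
    have e : (3 : ℝ) ^ (d + 1) * (Real.sqrt (Fintype.card ι) * cK) = X / K * Real.exp (-1) := by
      rw [hcK_def, hX]
      calc (3 : ℝ) ^ (d + 1) * (Real.sqrt (Fintype.card ι) * (C₂ / K))
          = (3 : ℝ) ^ (d + 1) * Real.sqrt (Fintype.card ι) * C₂ / K * (Real.exp 1 * Real.exp (-1)) := by
            rw [hexp]; ring
        _ = (3 : ℝ) ^ (d + 1) * Real.sqrt (Fintype.card ι) * C₂ * Real.exp 1 / K * Real.exp (-1) := by ring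
    rw [e]
    have : X / K ≤ 1 := div_le_one_of_le₀ hKX (Nat.cast_nonneg K)
    calc X / K * Real.exp (-1) ≤ 1 * Real.exp (-1) := mul_le_mul_of_nonneg_right this (Real.exp_pos _).le
      _ = Real.exp (-1) := one_mul _
  set αP : ℝ := Real.sqrt (Fintype.card ι) * C₁
    + ((d : ℝ) + 1) * (D1 hprof + D2 hprof) / K
        * ((Fintype.card ι : ℝ) * (Real.sqrt (Fintype.card ι) * C₁)) with hαP
  set c₁ : ℝ := 2 ^ (d + 3) * Real.exp (19 / 8) * αP + 1 with hc₁
  refine ⟨K, hK8, h4, c₁, by positivity, fun creg β hcreg hβ => ?_⟩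
  obtain ⟨e₁, he₁, h₁'⟩ := h₁ creg β hcreg hβ (2 * K)
  obtain ⟨e₂, he₂, h₂'⟩ := h₂ creg β hcreg hβ (2 * K) K hK1
  refine ⟨min e₁ e₂, lt_min he₁ he₂, ?_⟩
  intro k hk hn a m2 ea1 ea2 em1 em2 Mb hM hKM Ac e he hle h17 μ x hxμ P _ D hD f hfP φ hφ hf i
  have hn2 : 2 ≤ (ℓ + 1) ^ k := by
    calc 2 ≤ ℓ + 1 := by omega
      _ = (ℓ + 1) ^ 1 := (pow_one _).symm
      _ ≤ (ℓ + 1) ^ k := Nat.pow_le_pow_right (Nat.succ_pos ℓ) hk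
  have hnK : 16 ≤ (ℓ + 1) ^ k * K := by nlinarith
  have hnK3 : 3 ≤ (ℓ + 1) ^ k * K := le_trans (by norm_num) hnK
  have ha' : 0 < a := lt_of_lt_of_le ha ea1
  set AcS : (Fin (d + 1) → ℤ) → (Fin (d + 1) → ℤ) → Fin (d + 1) → ℝ :=
    fun j y => Ac (y + fun i => (((ℓ + 1) ^ k : ℕ) : ℤ) * (cubeLo Mb K j i : ℤ)) with hAcS
  have hregS : ∀ j, ∀ y ∈ Box d ℓ k (cubeMs Mb K j), ∀ μ ν : Fin (d + 1),
      |AcS j (y + e1 μ) ν - AcS j y ν| ≤ creg * e ^ (β - 1) / ((ℓ + 1) ^ k : ℕ) :=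
    fun j => regular_shift (Mb := Mb) (K := K) j h17
  have hMs1 : ∀ j ∈ labelsK Mb K, ∀ μ, 1 ≤ cubeMs Mb K j μ := fun j hj μ => one_le_cubeMs hK1 hKM hM hj μ
  have hMsS : ∀ j ∈ labelsK Mb K, ∀ μ, cubeMs Mb K j μ ≤ 2 * K := fun j hj μ => cubeMs_le hK1 hKM hM hj μ
  have hMsK : ∀ j ∈ labelsK Mb K, ∀ μ, K ∣ cubeMs Mb K j μ := fun j hj μ => dvd_cubeMs hK1 hKM hM hj μ
  have hMs3 : ∀ j ∈ labelsK Mb K, ∀ μ, 3 ≤ (ℓ + 1) ^ k * cubeMs Mb K j μ := fun j hj μ =>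
    hnK3.trans (Nat.mul_le_mul_left _ (Nat.le_of_dvd (hMs1 j hj μ) (hMsK j hj μ)))
  have hsub : ∀ j, subField ℓ k Mb (cubeMs Mb K j) (cubeLo Mb K j) (cube_ho Mb K j)
      (fun u v : ↥(Box d ℓ k Mb) => compField Ac u.1 v.1)
      = fun u v : ↥(Box d ℓ k (cubeMs Mb K j)) => compField (AcS j) u.1 v.1 :=
    fun j => subField_compField j Ac
  have hG : ∀ j ∈ labelsK Mb K, ∀ Φ : ↥(Box d ℓ k (cubeMs Mb K j)) × ι → ℝ,
      supN (greenA d F (e / ((ℓ + 1) ^ k : ℕ)) ℓ k a m2 (cubeMs Mb K j) (baseEmb hn _) (stairContour hn _)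
          (subField ℓ k Mb (cubeMs Mb K j) (cubeLo Mb K j) (cube_ho Mb K j)
            (fun u v : ↥(Box d ℓ k Mb) => compField Ac u.1 v.1)) *ᵥ Φ) ≤ C₁ * supN Φ := by
    intro j hj Φ
    rw [hsub j]
    exact (h₁' k hk hn a m2 ea1 ea2 em1 em2 (cubeMs Mb K j) (hMs1 j hj) (hMsS j hj) (hMs3 j hj) (AcS j) e he
      (hle.trans (min_le_left _ _)) (hregS j) Φ).1
  have hDG : ∀ j ∈ labelsK Mb K, ∀ Φ : ↥(Box d ℓ k (cubeMs Mb K j)) × ι → ℝ,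
      supN (derivA d F (e / ((ℓ + 1) ^ k : ℕ)) ℓ k (cubeMs Mb K j)
          (subField ℓ k Mb (cubeMs Mb K j) (cubeLo Mb K j) (cube_ho Mb K j)
            (fun u v : ↥(Box d ℓ k Mb) => compField Ac u.1 v.1)) μ
        *ᵥ (greenA d F (e / ((ℓ + 1) ^ k : ℕ)) ℓ k a m2 (cubeMs Mb K j) (baseEmb hn _) (stairContour hn _)
          (subField ℓ k Mb (cubeMs Mb K j) (cubeLo Mb K j) (cube_ho Mb K j)
            (fun u v : ↥(Box d ℓ k Mb) => compField Ac u.1 v.1)) *ᵥ Φ)) ≤ C₁ * supN Φ := by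
    intro j hj Φ
    rw [hsub j]
    exact (h₁' k hk hn a m2 ea1 ea2 em1 em2 (cubeMs Mb K j) (hMs1 j hj) (hMsS j hj) (hMs3 j hj) (AcS j) e he
      (hle.trans (min_le_left _ _)) (hregS j) Φ).2 μ
  have hKG : ∀ j ∈ labelsK Mb K, ∀ Φ : ↥(Box d ℓ k (cubeMs Mb K j)) × ι → ℝ,
      supN (kOp F (e / ((ℓ + 1) ^ k : ℕ)) ((ℓ + 1) ^ k) (B1.aSeq a ((ℓ : ℝ) + 1) k) m2 (cubeMs Mb K j)
            (baseEmb hn _) (stairContour hn _)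
            (subField ℓ k Mb (cubeMs Mb K j) (cubeLo Mb K j) (cube_ho Mb K j)
              (fun u v : ↥(Box d ℓ k Mb) => compField Ac u.1 v.1))
            (hBox ((ℓ + 1) ^ k) K (cubeMs Mb K j) (jloc j))
          *ᵥ (greenA d F (e / ((ℓ + 1) ^ k : ℕ)) ℓ k a m2 (cubeMs Mb K j) (baseEmb hn _) (stairContour hn _)
              (subField ℓ k Mb (cubeMs Mb K j) (cubeLo Mb K j) (cube_ho Mb K j)
                (fun u v : ↥(Box d ℓ k Mb) => compField Ac u.1 v.1))
            *ᵥ (mulH (ι := ι) (hBox ((ℓ + 1) ^ k) K (cubeMs Mb K j) (jloc j)) *ᵥ Φ))) ≤ cK * supN Φ := by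
    intro j hj Φ
    rw [hsub j]
    exact h₂' k hk hn hnK3 a m2 ea1 ea2 em1 em2 (cubeMs Mb K j) (hMs1 j hj) (hMsS j hj) (hMsK j hj) (jloc j)
      (AcS j) e he (hle.trans (min_le_right _ _)) (hregS j) Φ
  have main := thm110_deriv_boxCut F (e / ((ℓ + 1) ^ k : ℕ)) hℓ hk hn hd Mb hM hK8 h4 hKM ha' em1
    (fun u v : ↥(Box d ℓ k Mb) => compField Ac u.1 v.1) (fun _ u v => compField Ac u.1 v.1)
    (fun _ _ _ _ _ => rfl) hC₁.le hC₁.le hcK hG μ hDG hKG h3 x hxμ P hD f hfP hφ hf i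
  refine main.trans (mul_le_mul_of_nonneg_right (mul_le_mul_of_nonneg_right ?_ (Real.exp_pos _).le) hφ)
  rw [hc₁]
  linarith

end Main

end

end Literature.MathematicalPhysics.QuantumFieldTheory.Balaban1983to89.B4Thm110BoxNoCollar
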